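import Summits.BirchSwinnertonDyer.Rank1Residual.Supersingular.PlusSymbolParityTwo
import Summits.BirchSwinnertonDyer.Rank1Residual.Supersingular.BlindInterpolationFlatTwo
import Summits.BirchSwinnertonDyer.BirchSwinnertonDyer.Theorems.ByReductionTypeAtTwoSupersingularSharpTwo
import Literature.Barriers.BirchSwinnertonDyer.PAdicFunctionalEquationSharpFlatTwoProofs
import Summits.BirchSwinnertonDyer.Rank1Residual.Supersingular.SignedLambdaParityTwoMazurTate
import HarnessLib

/-!
# AN-8S (cell `bsd-f1-sign2`, seat `-an`, GEN 2): `4 ∣ L♯(−2)` — the `χ₈`-twisted central symbol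
# `[1/8]⁺_f − [5/8]⁺_f` is EVEN when `a₂ = 0` and `N ≡ ±1 (mod 8)`

TURNKEY filing by the typer seat `bsd-f1-sign2-ty` (D-ty-4, STATUS 2026-08-27T16:26:00Z): the -an planner's
kernel-checked file `HOME/MEMO-an-data/g2/AN8FirstLemma.lean` sha16 790cde0c6b3618ad (`lean check` rc 0, 0 warnings,
0 sorries), re-filed VERBATIM (namespace `…F1Sign2An` ↦ the cell's `…Rank1Residual.F1Sign2`; helper docstrings added).
REF2 v5 slot: the forced-value mechanism is printed mathematics at the value level (Sprung 2012 table); beyond-print label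
for the `χ₈`-evenness statement itself: -an «yes, modest», REF2 g5 adjudicating. PARTITION: none moved.

THEOREMS ONLY (no definition, no named fact). For `f ∈ S₂(Γ₀(N))` the newform of `E = W`
(globally minimal) with good supersingular reduction at `2`, `a₂(E) = 0`, and `χ₈(N) = +1`, and
`(L♯, L♭)` ANY Sprung pair of `f` at `2` (`IsSprungPair f 2 0 L♯ L♭`):

* `four_dvd_evalAt_sharp_neg_two_of_chi8` — **`4 ∣ L♯(−2)`** in `ℤ₂` (`T = −2 ↔ χ₈`, the second
  fixed point of `ι`);
* `norm_sub_ratPlusSymbol_eighth_lt_one_of_chi8` — hence **`‖[1/8]⁺_f − [5/8]⁺_f‖₂ < 1`** (the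
  `χ₈`-twisted central modular symbol is even), by `L♯(−2) = −2([1/8]⁺ − [5/8]⁺)`
  (`BlindLever.coe_evalAt_sharp_neg_two_eq`).

This is the `T = −2` twin of the tree's T-PAR2 (`norm_ratPlusSymbol_zero_lt_one_of_sign`, `T = 0`:
`‖[0]⁺_f‖₂ < 1` under `w·χ₈(N) = +1`) and the `♯` twin of `BlindLever.two_dvd_evalAt_flat_neg_two`
(`2 ∣ L♭(−2)` under `σχ₈(N) = +1`); here NO root-number condition enters. MECHANISM (value input +
functional equation, a congruence at the second fixed point — not an order statement, so the
catalogued barrier `PAdicFunctionalEquationSeesOnlyParity` does not apply):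
(1) `ℓ₀ = L♯(0) = −4[0]⁺_f` (`constantCoeff_sharp_two_of_isCongrModOmega_one`) and `‖[0]⁺‖₂ ≤ 1`
(`w = +1`: T-PAR2; `w = −1`: `L(E,1) = 0`, `[0]⁺ = 0`), so `4 ∣ ℓ₀`;
(2) the functional equation `L♯(ιT) = σ(1+T)^{c+a}L♯(T)`, `3a = −2`, `η_N 5^c ≡ N`
(`exists_functionalEquation_sharp_flat_two`), where `c + a ∈ 2ℤ₂` iff `χ₈(N) = +1`
(`neg_one_pow_val_eq_chi8`); its `T¹`-coefficient `−ℓ₁ = σ(ℓ₁ + (c+a)ℓ₀)` (`σ = +1`) or its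
`T²`-coefficient `ℓ₁ + ℓ₂ = σ(ℓ₂ + (c+a)ℓ₁ + C(c+a,2)ℓ₀)` (`σ = −1`) gives `2 ∣ ℓ₁`;
(3) `L♯(−2) = ℓ₀ − 2ℓ₁ + 4·(tail)(−2)`.
Census (cheapest falsifier, 0 violations): `v₂(L(E^{(2)},1)/Ω) ≥ 1` on all `4 360` rank-`0` twists
`E^{(d)}`, `d ∈ {−1, ±2}`, `N ≡ ±1 (8)` of the g2 packet table (HOME/MEMO-an-data/g2/an8_dist_stdout.txt);
control `N ≡ ±3`: `v₂ = 0` on `3 165/6 832`.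
References: [Sprung2017] Cor. 4.4, Cor. 4.11 (row p = 2), Cor. 4.14; [MazurTateTeitelbaum1986Invent]
§I.17; [GreenbergLNM1716] §1, §5 p. 181.
-/

set_option autoImplicit false

noncomputable section

open scoped Classical MatrixGroups ModularForm

open PowerSeries CongruenceSubgroup Literature.NumberTheory.EllipticCurves
  Literature.NumberTheory.EllipticCurves.ModularForms Literature.NumberTheory.EllipticCurves.Sprung2017
  Literature.Barriers.BirchSwinnertonDyer Summit.BirchSwinnertonDyer.Rank1Residual.Supersingular
  Summit.BirchSwinnertonDyer.BirchSwinnertonDyer.Theorems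

namespace Summit.BirchSwinnertonDyer.Rank1Residual.F1Sign2

/-! ### §1. Coefficients of `T¹`, `T²` under `T ↦ ι(T) = (1+T)⁻¹ − 1` and of a product -/

section Coeff

variable {R : Type*} [CommRing R]

/-- `[T¹] g(ιT) = −g₁` (`ι = −T + T² − …`). [folklore] -/
theorem coeff_one_subst_invOnePlusSubOne (g : R⟦X⟧) :
    coeff 1 (g.subst (invOnePlusSubOne : R⟦X⟧)) = -coeff 1 g := by
  have hι : constantCoeff (invOnePlusSubOne : R⟦X⟧) = 0 := constantCoeff_invOnePlusSubOne
  rw [coeff_subst' (HasSubst.of_constantCoeff_zero' hι), finsum_eq_single _ 1]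
  · rw [pow_one, coeff_one_invOnePlusSubOne, smul_eq_mul, mul_neg_one]
  · intro d hd
    rcases Nat.lt_or_gt_of_ne hd with h | h
    · obtain rfl : d = 0 := by omega
      rw [pow_zero, coeff_one, if_neg one_ne_zero, smul_zero]
    · rw [coeff_of_lt_order 1 (lt_of_lt_of_le (by exact_mod_cast h) (natCast_le_order_pow hι d)),
        smul_zero]

/-- `[T²] g(ιT) = g₁ + g₂` (`[T²]ι = 1`, `[T²]ι² = 1`). [folklore] -/
theorem coeff_two_subst_invOnePlusSubOne (g : R⟦X⟧) :
    coeff 2 (g.subst (invOnePlusSubOne : R⟦X⟧)) = coeff 1 g + coeff 2 g := by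
  have hι : constantCoeff (invOnePlusSubOne : R⟦X⟧) = 0 := constantCoeff_invOnePlusSubOne
  rw [coeff_subst' (HasSubst.of_constantCoeff_zero' hι),
    finsum_eq_sum_of_support_subset _ (s := ({1, 2} : Finset ℕ)) ?_]
  · rw [Finset.sum_pair (by norm_num), pow_one, coeff_invOnePlusSubOne, if_neg two_ne_zero,
      coeff_pow_self_of_constantCoeff_eq_zero hι 2, coeff_one_invOnePlusSubOne]
    simp
  · intro d hd
    rw [Function.mem_support] at hd
    simp only [Finset.coe_insert, Finset.coe_singleton, Set.mem_insert_iff, Set.mem_singleton_iff]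
    by_contra hne
    push Not at hne
    apply hd
    rcases Nat.lt_or_ge d 3 with h | h
    · obtain rfl : d = 0 := by omega
      rw [pow_zero, coeff_one, if_neg two_ne_zero, smul_zero]
    · rw [coeff_of_lt_order 2 (lt_of_lt_of_le (by exact_mod_cast (by omega : 2 < d))
        (natCast_le_order_pow hι d)), smul_zero]

/-- `[T¹](B·g) = B₀g₁ + B₁g₀`. [folklore] -/
theorem coeff_one_mul' (B g : R⟦X⟧) :
    coeff 1 (B * g) = coeff 0 B * coeff 1 g + coeff 1 B * coeff 0 g := by
  rw [coeff_mul, Finset.Nat.sum_antidiagonal_eq_sum_range_succ_mk, Finset.sum_range_succ,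
    Finset.sum_range_succ, Finset.sum_range_zero]
  simp

/-- `[T²](B·g) = B₀g₂ + B₁g₁ + B₂g₀`. [folklore] -/
theorem coeff_two_mul' (B g : R⟦X⟧) :
    coeff 2 (B * g) = coeff 0 B * coeff 2 g + coeff 1 B * coeff 1 g + coeff 2 B * coeff 0 g := by
  rw [coeff_mul, Finset.Nat.sum_antidiagonal_eq_sum_range_succ_mk, Finset.sum_range_succ,
    Finset.sum_range_succ, Finset.sum_range_succ, Finset.sum_range_zero]
  simp

/-- `g(t) = g₀ + t·g₁ + t²·(tail)(t)` for the disc evaluation `BlindLever.evalAt`. [folklore] -/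
theorem exists_evalAt_eq {p : ℕ} [Fact p.Prime] {t : ℤ_[p]} (ht : ‖t‖ < 1) (g : PowerSeries ℤ_[p]) :
    ∃ r : ℤ_[p], BlindLever.evalAt t g = coeff 0 g + t * coeff 1 g + t ^ 2 * r := by
  set g₁ : PowerSeries ℤ_[p] := PowerSeries.mk fun n => coeff (n + 1) g with hg₁
  set g₂ : PowerSeries ℤ_[p] := PowerSeries.mk fun n => coeff (n + 1) g₁ with hg₂
  have h1 : g = X * g₁ + C (constantCoeff g) := eq_X_mul_shift_add_const g
  have h2 : g₁ = X * g₂ + C (constantCoeff g₁) := eq_X_mul_shift_add_const g₁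
  have hc1 : constantCoeff g₁ = coeff 1 g := by
    rw [← coeff_zero_eq_constantCoeff_apply, hg₁, coeff_mk]
  refine ⟨BlindLever.evalAt t g₂, ?_⟩
  have e := congrArg (BlindLever.evalAtHom ht) h1
  rw [h2, map_add, map_mul, map_add, map_mul, BlindLever.evalAtHom_apply,
    BlindLever.evalAtHom_apply, BlindLever.evalAtHom_apply, BlindLever.evalAtHom_apply,
    BlindLever.evalAtHom_apply, BlindLever.evalAt_X, BlindLever.evalAt_C, BlindLever.evalAt_C, hc1] at e
  rw [e, coeff_zero_eq_constantCoeff_apply]; ring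

end Coeff

/-! ### §2. `4 ∣ L♯(−2)` at `a₂ = 0`, `χ₈(N) = +1` -/

section Main

variable {W : WeierstrassCurve ℚ} [W.IsElliptic] [W.IsGloballyMinimal] [NeZero (W.conductorNorm ℤ)]
  {f : CuspForm (Gamma0 (W.conductorNorm ℤ)) 2}

/-- `‖2‖₂ = ½` in `ℚ₂`. [folklore] -/
private theorem norm_two : ‖(2 : ℚ_[2])‖ = 2⁻¹ := by exact_mod_cast @Padic.norm_p 2 _

/-- **Step (1): `4 ∣ L♯(0)`** for any Sprung pair at `2` of the newform of `E = W`, `a₂(E) = 0`,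
`χ₈(N) = +1`: `L♯(0) = −4[0]⁺_f` and `‖[0]⁺_f‖₂ ≤ 1` (`w = +1`: T-PAR2; `w = −1`: `[0]⁺ = 0`).
[cite: Sprung2017, Cor. 4.11 (row p = 2)] -/
theorem four_dvd_constantCoeff_sharp_of_chi8 (hf : IsNewformOf W f)
    (hgood : W.HasGoodReductionAtPrime 2) (ha0 : W.frobeniusTrace 2 = 0)
    (hχ : ZMod.χ₈ (W.conductorNorm ℤ : ZMod 8) = 1) {Ls Lf : IwasawaAlgebra 2} (hSP : IsSprungPair f 2 0 Ls Lf) :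
    (4 : ℤ_[2]) ∣ PowerSeries.constantCoeff Ls := by
  have hN2 : ¬ 2 ∣ W.conductorNorm ℤ := not_dvd_level_of_isNewformOf hf hgood
  have hap : cuspCoeff f 2 = ((0 : ℤ) : ℂ) := by
    rw [cuspCoeff_eq_frobeniusTrace_of_isNewformOf_holds hf hgood, ha0]
  have hc0 := constantCoeff_sharp_two_of_isCongrModOmega_one hf.1 hf.coeffField_eq_bot hN2 hap (hSP 1)
  have hc0' : ((PowerSeries.constantCoeff Ls : ℤ_[2]) : ℚ_[2]) =
      -4 * ((ratPlusSymbol f 0 : ℚ) : ℚ_[2]) := by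
    rw [hc0]; push_cast; ring
  -- `‖[0]⁺‖ ≤ 1`
  have hsym : ‖((ratPlusSymbol f 0 : ℚ) : ℚ_[2])‖ ≤ 1 := by
    rcases W.rootNumber_eq_one_or with hw | hw
    · have hsign : W.rootNumber * ZMod.χ₈ (W.conductorNorm ℤ : ZMod 8) = 1 := by rw [hw, hχ, one_mul]
      have hT : ‖((ratPlusSymbol f 0 : ℚ) : ℚ_[2])‖ < 1 :=
        norm_ratPlusSymbol_zero_lt_one_of_isSprungPair_two (a := 0) (σ := W.rootNumber)
          (Ls := Ls) (Lf := Lf) hf.1 hf.coeffField_eq_bot hN2 hap (dvd_zero 2)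
          W.rootNumber_eq_one_or (isFrickeEigen_neg_rootNumber hf) hsign hSP
      exact hT.le
    · have hL := WeierstrassCurve.entireLFunction_one_eq_zero_of_rootNumber_eq_neg_one hw
      rw [hf.entireLFunction_one_eq] at hL
      have hpos : 0 < plusPeriod f := IsNewform0.plusPeriod_pos_holds hf.1 hf.coeffField_eq_bot
      have h0 : ratPlusSymbol f 0 = 0 := by
        have h' : ((ratPlusSymbol f 0 : ℚ) : ℝ) * plusPeriod f = 0 := by exact_mod_cast hL
        rcases mul_eq_zero.mp h' with h | h
        · exact_mod_cast h
        · exact absurd h hpos.ne'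
      rw [h0]; simp
  have hnorm : ‖(PowerSeries.constantCoeff Ls : ℤ_[2])‖ ≤ (2 : ℝ) ^ (-(2 : ℕ) : ℤ) := by
    rw [PadicInt.norm_def, hc0', norm_mul, show (-4 : ℚ_[2]) = -(2 ^ 2) by norm_num, norm_neg,
      norm_pow, norm_two]
    calc (2 : ℝ)⁻¹ ^ 2 * ‖((ratPlusSymbol f 0 : ℚ) : ℚ_[2])‖ ≤ (2 : ℝ)⁻¹ ^ 2 * 1 := by gcongr
      _ = (2 : ℝ) ^ (-(2 : ℕ) : ℤ) := by norm_num
  have hmem := (PadicInt.norm_le_pow_iff_mem_span_pow _ 2).mp (by exact_mod_cast hnorm)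
  rw [Ideal.mem_span_singleton] at hmem
  have h4 : (((2 : ℕ) : ℤ_[2]) ^ 2 : ℤ_[2]) = 4 := by norm_num
  rwa [h4] at hmem

/-- **`4 ∣ L♯(−2)` when `a₂(E) = 0` and `χ₈(N) = +1`** (AN-8S), for ANY Sprung pair at `2` of the
newform `f ∈ S₂(Γ₀(N))` of `E = W`. [cite: Sprung2017, Cor. 4.4, Cor. 4.11, Cor. 4.14]
[cite: MazurTateTeitelbaum1986Invent, §I.17] [cite: GreenbergLNM1716, §1 and §5 (p. 181)] -/
theorem four_dvd_evalAt_sharp_neg_two_of_chi8 (hf : IsNewformOf W f)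
    (hgood : W.HasGoodReductionAtPrime 2) (ha0 : W.frobeniusTrace 2 = 0)
    (hχ : ZMod.χ₈ (W.conductorNorm ℤ : ZMod 8) = 1) {Ls Lf : IwasawaAlgebra 2} (hSP : IsSprungPair f 2 0 Ls Lf) :
    (4 : ℤ_[2]) ∣ BlindLever.evalAt (-2 : ℤ_[2]) Ls := by
  -- (1) `ℓ₀ = 4m`
  obtain ⟨m, hm⟩ := four_dvd_constantCoeff_sharp_of_chi8 hf hgood ha0 hχ hSP
  have hm' : coeff 0 Ls = 4 * m := by rw [coeff_zero_eq_constantCoeff_apply, hm]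
  -- (2) the functional equation and the parity of its exponent
  obtain ⟨σ, hσ, -, ηN, c, a, b, hc, ha3, -, hFE⟩ :=
    exists_functionalEquation_sharp_flat_two hf hgood ha0
  obtain ⟨hFEs, -⟩ := hFE Ls Lf hSP
  -- `c` is even: `(−1)^{c mod 2} = χ₈(N) = 1`
  have hpar := neg_one_pow_val_eq_chi8 (N := W.conductorNorm ℤ) (n := 1) le_rfl (hc 1)
  rw [hχ] at hpar
  have hval : (PadicInt.toZModPow 1 c).val = 0 := by
    have hlt : (PadicInt.toZModPow 1 c).val < 2 := by
      simpa using (PadicInt.toZModPow 1 c).val_lt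
    rcases Nat.lt_or_ge (PadicInt.toZModPow 1 c).val 1 with h | h
    · omega
    · exfalso
      have h1 : (PadicInt.toZModPow 1 c).val = 1 := by omega
      rw [h1, pow_one] at hpar
      norm_num at hpar
  have hc2 : (2 : ℤ_[2]) ∣ c := by
    have hker : c ∈ RingHom.ker (PadicInt.toZModPow (p := 2) 1) := by
      rw [RingHom.mem_ker]; exact (ZMod.val_eq_zero _).mp hval
    rw [PadicInt.ker_toZModPow, Ideal.mem_span_singleton, pow_one] at hker
    exact hker
  obtain ⟨c', hc'⟩ := hc2
  -- `a = −2/3` is even: `a = 2(−1 − a)`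
  have ha' : a = 2 * (-1 - a) := by linear_combination ha3
  -- the exponent `x = c + a = 2y`
  set x : ℤ_[2] := c + a with hx
  have hxy : x = 2 * (c' + (-1 - a)) := by rw [hx, hc', mul_add, ← ha']
  set y : ℤ_[2] := c' + (-1 - a) with hy
  -- coefficients of the binomial series
  set B : IwasawaAlgebra 2 := PowerSeries.binomialSeries ℤ_[2] x with hB
  have hB0 : coeff 0 B = 1 := by
    rw [hB, PowerSeries.binomialSeries_coeff, Ring.choose_zero_right, one_smul]
  have hB1 : coeff 1 B = x := by
    rw [hB, PowerSeries.binomialSeries_coeff, Ring.choose_one_right, smul_eq_mul, mul_one]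
  -- rewrite the sign as a constant
  have hσC : ((σ : ℤ) : IwasawaAlgebra 2) = C ((σ : ℤ) : ℤ_[2]) := by
    rw [map_intCast]
  rw [hσC, mul_assoc] at hFEs
  -- (E1) coefficient of `T¹`, (E2) coefficient of `T²`
  have E1 := congrArg (coeff 1) hFEs
  rw [coeff_one_subst_invOnePlusSubOne, coeff_C_mul, coeff_one_mul', hB0, hB1, one_mul, hm']
    at E1
  have E2 := congrArg (coeff 2) hFEs
  rw [coeff_two_subst_invOnePlusSubOne, coeff_C_mul, coeff_two_mul', hB0, hB1, one_mul, hm']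
    at E2
  -- `2 ∣ ℓ₁`
  have h2l1 : (2 : ℤ_[2]) ∣ coeff 1 Ls := by
    rcases hσ with rfl | rfl
    · -- `−ℓ₁ = ℓ₁ + x·4m`
      refine ⟨-(x * m), ?_⟩
      have h : (2 : ℤ_[2]) * coeff 1 Ls = 2 * (2 * -(x * m)) := by
        push_cast at E1; linear_combination (-1 : ℤ_[2]) * E1
      exact mul_left_cancel₀ two_ne_zero h
    · -- `ℓ₁ + ℓ₂ = −(ℓ₂ + xℓ₁ + B₂·4m)`, `x = 2y`
      refine ⟨-(coeff 2 Ls) - y * coeff 1 Ls - 2 * coeff 2 B * m, ?_⟩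
      push_cast at E2
      rw [hxy] at E2
      linear_combination E2
  obtain ⟨k, hk⟩ := h2l1
  -- (3) `L♯(−2) = ℓ₀ − 2ℓ₁ + 4·r`
  obtain ⟨r, hr⟩ := exists_evalAt_eq BlindLever.norm_neg_two_lt_one Ls
  rw [hr, hm', hk]
  exact ⟨m - k + r, by ring⟩

/-- **The `χ₈`-twisted central symbol is even: `‖[1/8]⁺_f − [5/8]⁺_f‖₂ < 1`** for `f` the newform
of `E = W` with good supersingular reduction at `2`, `a₂(E) = 0` and `χ₈(N) = +1` — from
`four_dvd_evalAt_sharp_neg_two_of_chi8` and `L♯(−2) = −2([1/8]⁺ − [5/8]⁺)`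
(`BlindLever.coe_evalAt_sharp_neg_two_eq`) for the pair `exists_isSprungPair_two`.
[cite: Sprung2017, Cor. 4.4] [cite: MazurTateTeitelbaum1986Invent, §I.17] -/
theorem norm_sub_ratPlusSymbol_eighth_lt_one_of_chi8 (hf : IsNewformOf W f)
    (hgood : W.HasGoodReductionAtPrime 2) (ha0 : W.frobeniusTrace 2 = 0)
    (hχ : ZMod.χ₈ (W.conductorNorm ℤ : ZMod 8) = 1) :
    ‖((ratPlusSymbol f ((1 : ℚ) / 8) - ratPlusSymbol f ((5 : ℚ) / 8) : ℚ) : ℚ_[2])‖ < 1 := by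
  have ha : (2 : ℤ) ∣ W.frobeniusTrace 2 := by rw [ha0]; exact dvd_zero 2
  obtain ⟨Ls, Lf, hSP⟩ := exists_isSprungPair_two hf hgood ha
  rw [ha0] at hSP
  have hap : cuspCoeff f 2 = ((0 : ℤ) : ℂ) := by
    rw [cuspCoeff_eq_frobeniusTrace_of_isNewformOf_holds hf hgood, ha0]
  have hcoe := BlindLever.coe_evalAt_sharp_neg_two_eq hf.1 hf.coeffField_eq_bot
    (not_dvd_level_of_isNewformOf hf hgood) hap (dvd_zero 2) hSP
  obtain ⟨k, hk⟩ := four_dvd_evalAt_sharp_neg_two_of_chi8 hf hgood ha0 hχ hSP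
  have h4 : ((BlindLever.evalAt (-2 : ℤ_[2]) Ls : ℤ_[2]) : ℚ_[2]) = 4 * (k : ℚ_[2]) := by
    rw [hk]; push_cast [PadicInt.coe_mul]; rfl
  rw [h4] at hcoe
  have hS : ((ratPlusSymbol f ((1 : ℚ) / 8) - ratPlusSymbol f ((5 : ℚ) / 8) : ℚ) : ℚ_[2]) =
      -2 * (k : ℚ_[2]) := by
    push_cast at hcoe ⊢
    linear_combination ((1 : ℚ_[2]) / 2) * hcoe
  have hk1 : ‖(k : ℚ_[2])‖ ≤ 1 := PadicInt.norm_le_one k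
  rw [hS, norm_mul, norm_neg, norm_two]
  calc (2 : ℝ)⁻¹ * ‖(k : ℚ_[2])‖ ≤ (2 : ℝ)⁻¹ * 1 := by gcongr
    _ < 1 := by norm_num

end Main

end Summit.BirchSwinnertonDyer.Rank1Residual.F1Sign2
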